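import Summits.Langlands.Langlands.Theses.NonMotivicVoidSplit

/-!
# Route NonMotivicVoidSplit — Assembly

The assembly item (stmt-Langlands-27058) of the child route `NonMotivicVoidSplit` (decomp-langlands lens-2 gen 36 node,
writer-1 g11 thaw slot 10; `--refines route-Langlands-MotivicDictionarySplit:NonMotivicReciprocity`, the cell's route born
2026-09-01T02:58Z) for NMR = `MotivicDictionarySplit.NonMotivicReciprocity` (stmt-Langlands-27427):
`PotentiallyAbelianVoidReciprocity → OddPolarisedVoidReciprocity → RationalPlaneVoidReciprocity → NonMotivicCoreReciprocity →
 Summit.Langlands.Langlands.Theses.MotivicDictionarySplit.NonMotivicReciprocity`.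

This is literally the type of the route file's sorry-free deciding theorem `Summit.Langlands.Langlands.Theses.NonMotivicVoidSplit.closes`
(PAV, OPV, RPV, NMC ⟹ NMR, by pointwise excluded middle on the three potential dials). Nothing here proves `Langlands` (nor the parent
piece NMR): the assembly records only that the items of the route, taken together, imply the parent piece by name. Count-neutral.
-/

set_option linter.dupNamespace false -- project-wide option (lakefile weak.linter.dupNamespace); `Summit.Langlands.Langlands` is the mandated namespace

namespace Summit.Langlands.Langlands.Theorems

/-- **Assembly of route NonMotivicVoidSplit** (stmt-Langlands-27058):
`PotentiallyAbelianVoidReciprocity → OddPolarisedVoidReciprocity → RationalPlaneVoidReciprocity → NonMotivicCoreReciprocity →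
 Summit.Langlands.Langlands.Theses.MotivicDictionarySplit.NonMotivicReciprocity`.
Proof: unfold `Assembly` and apply the route's deciding theorem `Theses.NonMotivicVoidSplit.closes`. -/
theorem nonMotivicVoidSplit_assembly_proof :
    Summit.Langlands.Langlands.Theses.NonMotivicVoidSplit.Assembly := by
  unfold Summit.Langlands.Langlands.Theses.NonMotivicVoidSplit.Assembly
  exact Summit.Langlands.Langlands.Theses.NonMotivicVoidSplit.closes

end Summit.Langlands.Langlands.Theorems
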